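import Summits.ResolutionOfSingularities.ResolutionOfSingularities.Theorems.FrobeniusClosingPatchingRelPerfectDepthOneDictionaryStep
import Summits.ResolutionOfSingularities.ResolutionOfSingularities.Theorems.FrobeniusClosingPatchingRelPerfectCoreRungClosure
import Mathlib.FieldTheory.Perfect
import HarnessLib

/-!
# Chain W5.2 — typed TARGETS «F1» (plan-1 gen 6, CRUX-PLAN v3.3 §6j): the DEPTH-ℓ X-SIDE DICTIONARY
# (first instalment of «F» = rung R4 and beyond)

[OURS · L1 W5.2] Statements (Props) + three small sanity lemmas; NOT statements of the manuscript under
review; no named fact is used. Crux `PatchingRelPerfect` (stmt-ResolutionOfSingularities-16161), line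
`closed_point_slice`, open stub `stub_atomDimFourBlowup` (CORE).

WHY (kernel sentence v1.5, CRUX-PLAN v3.3 §7). For an ideal `I` of a regular local fourfold `S` with
`𝔪^{d+ℓ} ⊆ I ⊆ 𝔪^d` in the graded sense `HasExceptionalDepth ℓ x I` (`x_i^{d+ℓ} ∈ I`), the layered format
(p490550) on any blowing up `g : X → Spec S` of the closed point reads `I𝒪_X = 𝓘_E^d · K` with
`𝓘_E^ℓ ≤ K`: the pair `(K, ℓ)` is an idealistic exponent of maximal order `ℓ` on the regular fourfold `X`
and the exceptional divisor `E` is a GLOBAL REGULAR HYPERSURFACE OF MAXIMAL CONTACT in the literal sense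
`t^ℓ ∈ K` (`t` a local equation of `E`). Its singular locus `{x | ord_x K ≥ ℓ}` lies in `E`, its permissible
centres are the regular `Z ⊆ E` with `K ≤ 𝓘_Z^ℓ`, and — THIS FILE — the property `𝓘_E^ℓ ≤ K` together with
the whole X-side bookkeeping SURVIVES the blowing up of such a centre, the weight-`ℓ` INITIAL IDEAL
`K|_E` transforming by the weight-`ℓ` controlled transform along `Bl_Z E → E` (`DictionaryStepPow`, the
depth-`ℓ` version of D1 `DepthOneTargets.DictionaryStep`, p495681). The restriction of `(K, ℓ)` to `E` is
the coefficient idealistic filtration `{(𝔟_a, ℓ - a)}_{a < ℓ}` on the regular threefold `E` (for `ℓ = 2`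
the Rees algebra `𝒪_E[f₀W², f₁W]` of tri-1 TRIAGE v5 §6 = the coefficient flag of idea-1's card
`coefficient-flag-on-exceptional-p3`); its resolution in characteristic `p` (ambient dimension three,
generated in degrees `≤ ℓ`, base field = the PERFECT residue field `κ`) is the open content of rung R4
(`ℓ = 2`) and of the `𝔪`-primary stratum in general (`ℓ = 1` is r-d1 = CJS-B + CP). The depth classes are
NESTED and EXHAUST the `𝔪`-primary ideals (`HasExceptionalDepth.succ`, `hasExceptionalDepth_of_pow_le`).

## Contents
* `HasExceptionalDepth ℓ x I`, `HasExceptionalDepth.succ`, `hasExceptionalDepth_of_pow_le` (PROVED sanity);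
* `DepthInvariant ℓ S I E X i g K` — D1's `DepthOneInvariant` with the residual ideal `K` EXPOSED and
  `i.ker ^ ℓ ≤ K`;
* `DictionaryStepPow ℓ` — TARGET D_ℓ (stub-hand res-L1-w52-stub-5 = res-D-pv-016, author of D1);
* `ExceptionalPackagePow ℓ` — TARGET I_ℓ (the initial state; after I1 `ExceptionalPackage`, res-D-pv-055);
* `DepthConclusionPerfect ℓ` — the depth-`ℓ` rung's conclusion on the CORE's terms (residue field perfect).

## References (pointers in prose; bib keys of `docs/references.bib`)
* J. Kollár, *Lectures on Resolution of Singularities* (2007), 3.30.2, (3.111) Step 3. [Kollar2007]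
* U. Görtz, T. Wedhorn, *Algebraic Geometry I*, 2nd ed. (2020), Prop. 13.91 (1), 13.96 (2). [GortzWedhorn2020]
* E. Bierstone, D. Grigoriev, P. Milman, J. Włodarczyk, *Effective Hironaka resolution and its complexity*,
  Asian J. Math. 15 (2011), §3.2 (controlled transform). [BierstoneGrigorievMilmanWlodarczyk2011]
* Q. Liu, *Algebraic Geometry and Arithmetic Curves* (2002), Thm. 8.1.19. [Liu2002]
-/

-- `Summit.<Summit>.<Sub>.Theorems` with `Sub = Summit` (single-conjunct summit, D-0017)
set_option linter.dupNamespace false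

noncomputable section

open CategoryTheory CategoryTheory.Limits AlgebraicGeometry TopologicalSpace
open Literature.AlgebraicGeometry.Resolution

namespace Summit.ResolutionOfSingularities.ResolutionOfSingularities.Theorems.DepthTargets

universe u

/-! ## §1 Exceptional depth `ℓ` -/

/-- [OURS · L1 W5.2] **Exceptional depth `ℓ`**: `I ⊆ 𝔪ᵈ` and `x_i^{d+ℓ} ∈ I` for every member `x_i` of a
family spanning `𝔪`, for some `d` (`ℓ = 1` is `DepthOneTargets.HasExceptionalDepthOne`). On a blowing up of
the closed point the format is `I𝒪_X = 𝓘_E^d · K` with `𝓘_E^ℓ ≤ K` (p490550 `DepthOne.layeredFormat`).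
[cite: Liu2002, Thm. 8.1.19 (a)] -/
def HasExceptionalDepth (ℓ : ℕ) {S : Type u} [CommRing S] [IsLocalRing S] {n : ℕ} (x : Fin n → S)
    (I : Ideal S) : Prop :=
  ∃ d : ℕ, I ≤ IsLocalRing.maximalIdeal S ^ d ∧ ∀ i : Fin n, x i ^ (d + ℓ) ∈ I

/-- [OURS · L1 W5.2] The depth classes are nested: depth `ℓ` implies depth `ℓ + 1` (lower `d` by one).
[folklore] -/
theorem HasExceptionalDepth.succ {ℓ : ℕ} {S : Type u} [CommRing S] [IsLocalRing S] {n : ℕ}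
    {x : Fin n → S} {I : Ideal S} (h : HasExceptionalDepth ℓ x I) : HasExceptionalDepth (ℓ + 1) x I := by
  obtain ⟨d, hI, hx⟩ := h
  refine ⟨d - 1, hI.trans (Ideal.pow_le_pow_right (Nat.sub_le d 1)), fun i => ?_⟩
  rcases Nat.eq_zero_or_pos d with hd | hd
  · subst hd
    simpa [pow_succ] using I.mul_mem_right (x i) (hx i)
  · have : d - 1 + (ℓ + 1) = d + ℓ := by omega
    rw [this]
    exact hx i

/-- [OURS · L1 W5.2] Every `𝔪`-primary proper ideal has SOME exceptional depth: `𝔪^N ⊆ I ⊆ 𝔪` with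
`1 ≤ N` gives depth `N - 1` (with `d = 1`) for any family `x` inside `𝔪`. So the depth ladder exhausts the
`𝔪`-primary stratum. [folklore] -/
theorem hasExceptionalDepth_of_pow_le {S : Type u} [CommRing S] [IsLocalRing S] {n : ℕ}
    (x : Fin n → S) (hx : ∀ i, x i ∈ IsLocalRing.maximalIdeal S) (I : Ideal S) {N : ℕ} (hN : 1 ≤ N)
    (hle : IsLocalRing.maximalIdeal S ^ N ≤ I) (hI : I ≤ IsLocalRing.maximalIdeal S) :
    HasExceptionalDepth (N - 1) x I := by
  refine ⟨1, by simpa using hI, fun i => hle ?_⟩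
  have : 1 + (N - 1) = N := by omega
  rw [this]
  exact Ideal.pow_mem_pow (hx i) N

/-! ## §2 The depth-`ℓ` invariant and the dictionary step D_ℓ -/

/-- [OURS · L1 W5.2] **The depth-`ℓ` invariant** (X-side bookkeeping; D1's `DepthOneInvariant` with the
residual ideal `K` EXPOSED — for `ℓ ≥ 2` permissibility `K ≤ 𝓘_Z^ℓ` is not a property of `K|_E` alone).
`S` regular local, `I ⊆ S`; `g : X → Spec S` a blowing up along an ideal sheaf cosupported in the closed
point, `X` Noetherian and regular; `i : E ⟶ X` a closed immersion whose ideal `𝓘_E = i.ker` is an effective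
Cartier divisor, `E` regular and mapped to the closed point; `𝓘_E^ℓ ≤ K` (maximal contact, literal); and the
FORMAT `I𝒪_X = M · K` with `M` invertible. The E-side (initial, weight-`ℓ`) datum is `K|_E = K.comap i`.
[cite: Kollar2007, (3.111) Step 3] [cite: GortzWedhorn2020, Prop. 13.91 (1), 13.96 (2)] -/
structure DepthInvariant (ℓ : ℕ) (S : Type u) [CommRing S] [IsRegularLocalRing S] (I : Ideal S)
    (E X : Scheme.{u}) (i : E ⟶ X) (g : X ⟶ Spec (.of S)) (K : X.IdealSheafData) : Prop where
  /-- `X` is Noetherian -/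
  isNoetherian : IsNoetherian X
  /-- `X` is regular -/
  isRegular : Scheme.IsRegular X
  /-- `E` is regular -/
  isRegular_exc : Scheme.IsRegular E
  /-- `i : E ⟶ X` is a closed immersion … -/
  isClosedImmersion : IsClosedImmersion i
  /-- … whose ideal is an effective Cartier divisor -/
  isEffectiveCartier_ker : IsEffectiveCartier i.ker
  /-- `E` lies over the closed point of `Spec S` -/
  map_eq_closedPoint : ∀ e : E, g.base (i.base e) = IsLocalRing.closedPoint S
  /-- `g` is a blowing up along an ideal sheaf cosupported in the closed point -/
  exists_isBlowup_supported : ∃ K₀ : (Spec (.of S)).IdealSheafData, IsBlowup g K₀ ∧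
    (K₀.support : Set (Spec (.of S))) ⊆ {IsLocalRing.closedPoint S}
  /-- MAXIMAL CONTACT, literally: `𝓘_E^ℓ ≤ K` -/
  ker_pow_le : i.ker ^ ℓ ≤ K
  /-- the FORMAT `I𝒪_X = M · K`, `M` invertible -/
  exists_format : ∃ M : X.IdealSheafData, IsEffectiveCartier M ∧
    (affineBlowup.idealSheaf I).comap g = M * K

/-- [OURS · L1 W5.2] **TARGET D_ℓ — the depth-`ℓ` dictionary step** (`ℓ = 1`: D1 `DictionaryStep`,
p495681, res-D-pv-016). One blowing up `τ : E' → E` of the threefold along a centre `C` with `V(C)` regular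
which is PERMISSIBLE FOR `(K, ℓ)` — `K ≤ Ĉ^ℓ`, `Ĉ = C.map i` the ideal of `V(C) ⊂ E ⊂ X` — is matched by the
blowing up `σ : X' → X` along `Ĉ` preserving the invariant with `K' = σᶜ(K, ℓ) = (σ^*K : 𝓘_{exc}^ℓ)` the
weight-`ℓ` controlled transform, `E'` the strict transform (`i' ≫ σ = τ ≫ i`), and the E-side datum
transforming by the weight-`ℓ` controlled transform along `τ`: `K'|_{E'} = τᶜ(K|_E, ℓ)`. Intended proof =
D1's (`exists_isBlowup X Ĉ`; `IsBlowup.isRegular_of_isRegular_subscheme`; `strictTransformHom`, closed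
immersion by `IsBlowup.isClosedImmersion_of_comp_eq`; `i'.ker = σᶜ(𝓘_E, 1)` effective Cartier by
`IsBlowup.ker_strictTransformHom_of_isRegular`; `IsBlowup.exists_isBlowup_comp_supported`) with the
exponent-`ℓ` factorisation `σ^*K = 𝓘_{exc}^ℓ · K'` (`IsBlowup.pow_mul_controlledTransform_eq`, from
`K ≤ Ĉ^ℓ`), `M' = σ^*M · 𝓘_{exc}^ℓ`, `𝓘_{E'}^ℓ ≤ K'` (cancel `𝓘_{exc}^ℓ` in
`𝓘_{exc}^ℓ 𝓘_{E'}^ℓ = σ^*𝓘_E^ℓ ≤ σ^*K`), and the restriction identity by cancelling the effective Cartier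
divisor `(C𝒪_{E'})^ℓ` (`IsEffectiveCartier.eq_of_mul_eq_mul`). Chart check (`ℓ = 2`, `K = (f₀ + t f₁, t²)`,
centre `t = w = 0`, chart `w`): `K' = (f₀/w² + t' f₁/w, t'²)`. [cite: GortzWedhorn2020, Prop. 13.91 (1), 13.96 (2)]
[cite: Kollar2007, 3.30.2, (3.111) Step 3] [cite: BierstoneGrigorievMilmanWlodarczyk2011, §3.2] -/
def DictionaryStepPow (ℓ : ℕ) : Prop :=
  ∀ (S : Type u) [CommRing S] [IsRegularLocalRing S] (I : Ideal S)
    (E X : Scheme.{u}) (i : E ⟶ X) (g : X ⟶ Spec (.of S)) (K : X.IdealSheafData),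
    DepthInvariant ℓ S I E X i g K →
    ∀ (E' : Scheme.{u}) (τ : E' ⟶ E) (C : E.IdealSheafData),
      Scheme.IsRegular C.subscheme → K ≤ C.map i ^ ℓ → IsBlowup τ C →
        ∃ (X' : Scheme.{u}) (σ : X' ⟶ X) (i' : E' ⟶ X'),
          IsBlowup σ (C.map i) ∧ i' ≫ σ = τ ≫ i ∧
          DepthInvariant ℓ S I E' X' i' (σ ≫ g) (controlledTransform σ (C.map i) K ℓ) ∧
          (controlledTransform σ (C.map i) K ℓ).comap i' = controlledTransform τ C (K.comap i) ℓ

/-! ## §3 The initial state I_ℓ and the depth-`ℓ` conclusion -/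

/-- [OURS · L1 W5.2] **TARGET I_ℓ — the depth-`ℓ` exceptional package** (`ℓ = 1`: I1 `ExceptionalPackage`,
res-L1-w52-stub-3 p493964/p494999 + res-D-pv-055). For `S` regular local of dimension four, `x` spanning `𝔪`,
`I ≠ 0` of exceptional depth `ℓ`: the invariant holds at an initial state (`X = Bl_𝔪 Spec S`, `E` its
exceptional divisor, `M = 𝓘_E^d`, `K` from the layered format p490550) with `E` integral, Noetherian,
excellent, of dimension three and LOCALLY OF FINITE TYPE OVER THE RESIDUE FIELD `κ` (the structure
morphism `E → Spec κ` of p494999 `DepthOne.exists_hom_exceptional_residueField`; for `ℓ ≥ 2` the E-side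
resolution needs the base field, which is perfect on the CORE's terms). [cite: Liu2002, Thm. 8.1.19 (a)]
[cite: Kollar2007, (3.111) Step 3] -/
def ExceptionalPackagePow (ℓ : ℕ) : Prop :=
  ∀ (S : Type u) [CommRing S] [IsRegularLocalRing S], ringKrullDim S = (4 : ℕ) →
    ∀ (n : ℕ) (x : Fin n → S), Ideal.span (Set.range x) = IsLocalRing.maximalIdeal S →
    ∀ (I : Ideal S), I ≠ ⊥ → HasExceptionalDepth ℓ x I →
      ∃ (X E : Scheme.{u}) (g : X ⟶ Spec (.of S)) (i : E ⟶ X) (K : X.IdealSheafData)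
        (q : E ⟶ Spec (.of (IsLocalRing.ResidueField S))),
        DepthInvariant ℓ S I E X i g K ∧ IsIntegral E ∧ IsNoetherian E ∧ Scheme.IsExcellent E ∧
          topologicalKrullDim E = 3 ∧ LocallyOfFiniteType q

/-- [OURS · L1 W5.2] **The depth-`ℓ` rung, conclusion, on the CORE's terms** (blow-up form of the
registered core `stub_atomDimFourBlowup` on the depth-`ℓ` stratum; residue field PERFECT — for `ℓ = 1`
the perfectness is not needed: `DepthOneTargets.DepthOneConclusion`): every blowing up `T → Spec S` along
`I` carries a non-zero ideal sheaf cosupported in the closed fibre whose blowing up is regular. The union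
over `ℓ` is the whole `𝔪`-primary stratum (`hasExceptionalDepth_of_pow_le`). NOT a statement of the
manuscript. [cite: Kollar2007, (3.111) Step 3] -/
def DepthConclusionPerfect (ℓ : ℕ) : Prop :=
  ∀ (S : Type u) [CommRing S] [IsRegularLocalRing S], ringKrullDim S = (4 : ℕ) →
    PerfectField (IsLocalRing.ResidueField S) →
    ∀ (n : ℕ) (x : Fin n → S), Ideal.span (Set.range x) = IsLocalRing.maximalIdeal S →
    ∀ (I : Ideal S), I ≠ ⊥ → HasExceptionalDepth ℓ x I →
    ∀ (T : Scheme.{u}) (f : T ⟶ Spec (.of S)), IsBlowup f (affineBlowup.idealSheaf I) →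
      ∃ (J : T.IdealSheafData) (T' : Scheme.{u}) (π : T' ⟶ T), J ≠ ⊥ ∧
        (∀ t : T, t ∈ J.support → f.base t = IsLocalRing.closedPoint S) ∧
        IsBlowup π J ∧ Scheme.IsRegular T'

end Summit.ResolutionOfSingularities.ResolutionOfSingularities.Theorems.DepthTargets

end
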